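import Summits.Ventures.HodgeRepro2.T6N3Datum

/-!
# T6N3Interface — the interface Props of N3 over the datum (binders of the N3 mains)

Cell pub-hodge-repro2, Tier 6 (README §10), seat t6-p3 (N3 owner, M2). Record: TIER5 §N3 =
route/T5-N3-route-2.md v0.15 (N3.2 standing data, N3.4 = N3.L0–N3.L8, N3.7(b) standard inferences).

Every Prop below is a DEFINITIONAL property of the objects of the datum or one of the [A]-class
identities of N3.2–N3.4 (a standard inference the record writes out in one line), stated over the
datum `T6N3Datum.lean`. They are NOT displays (no printed statement is quoted here; TARGET-T6 §7(c)
does not apply) and NOT fields of the datum: they are BINDERS of the N3 mains, each tagged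
`[interface: <record step>; class: <M2 class per TARGET-T6 §9.5 if not discharged in kernel>]` —
AD = an [A]-class dictionary of Tier 5, IR = interface residual, EX = existence of the datum. The
printed theorems behind them (rows T1–T8 of N3.3) are displayed in `T6N3Hyp.lean` where a faithful
carrier exists; the dictionary display → interface Prop is what the M2 line counts.

Conventions as in T6N3Datum: Mathlib's `⟪x, y⟫_ℂ` is conjugate-linear in `x`; the record's `⟨a, b⟩ =
∫ a \overline{b}` is `⟪b, a⟫_ℂ`; `Θ φ f` is conjugate-linear in `f`.

§8(d): uses an L-value-free non-vanishing device: NO.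
-/

namespace Summit.Ventures.HodgeRepro2.T6

open scoped InnerProductSpace

namespace N3Side

variable {LG : Type} [NormedAddCommGroup LG] [InnerProductSpace ℂ LG] {Gf : Type} [Group Gf]
  (X : N3Side LG Gf)

/-- [interface: N3.L1 «`K_ψ ∈ C([H])`» — the lift in the other direction of a Schwartz datum is a
continuous function on the compact quotient (the kernel `θ(φ)` is continuous, row T6); class AD] -/
def KliftCont : Prop :=
  ∀ (φ : X.S) (ψ : LG), X.Klift φ ψ ∈ X.Cont

/-- [interface: the SEAM (N3.2) «`ℓ_A(ψ) = ∫_{[T₁₂]} χ₁₂(t) K_ψ(t) dt = P_{χ₁₂}(K_ψ)`, `φ := φ_a ⊗ φ_b`»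
— the factorisation (N3.1) of the theta kernel along `𝕏 = (V⊗W_a) ⊕ (V⊗W_b)` (rows T3 / T3′, HKS96
Cor. A.3 / Lemma 5.2) and Fubini on the compact `[T₁₂] × [G]` (N3.2(d)); class AD] -/
def Seam (hC : X.KliftCont) : Prop :=
  ∀ (φa : X.Sa) (φb : X.Sb) (ψ : LG),
    X.ell φa φb ψ = X.Ptor ⟨X.Klift (X.tensor φa φb) ψ, hC _ _⟩

/-- [interface: N3.L2 (adjoint identity; Fubini) «`⟨K_ψ, f⟩_{L²([H])} = ⟨Θ(f,φ), ψ⟩_{L²([G])}`» — in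
Mathlib's convention `⟪f, K_ψ⟫ = ⟪ψ, Θ(f, φ)⟫` (row T6 + Fubini on `[H] × [G]`); class AD] -/
def Adjoint : Prop :=
  ∀ (φ : X.S) (f : X.LH) (ψ : LG), ⟪f, X.Klift φ ψ⟫_ℂ = ⟪ψ, X.Θ φ f⟫_ℂ

/-- [interface: N3.L1 «`K_ψ` … right-`K`-invariant and `τ′`-isotypic under `K_∞^H`» for a `K`-fixed
Schwartz datum (`ω(k)φ₁₂,f = φ₁₂,f`; `k ∈ K_∞^H` acts through `ω(k)φ₁₂,∞ ∈ τ′`); class AD] -/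
def KliftLevel : Prop :=
  ∀ φ ∈ X.SKfix, ∀ ψ : LG, X.Klift φ ψ ∈ X.Kfix ⊓ X.τ'iso

/-- [interface: N3.L5(c) (isotypic confinement) «for `ψ ∈ σ`: `K_ψ ∈ Π(π₀)^{K,τ′}`» — the isotypic
part: `K_ψ ∈ Π(π₀)` (from (HD_v), row T2, through restricted tensor products, N3.L5(a)); class AD] -/
def KliftIsotypic : Prop :=
  ∀ φ ∈ X.SKfix, ∀ ψ ∈ X.σ, X.Klift φ ψ ∈ X.isotypic

/-- [interface: N3.L5(b) «for every `f ∈ Π` and `φ` as in (a): `Θ(f,φ) ∈ Π_G(σ) = σ`» ((HD_v) read as the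
uniqueness of the partner + `m(σ) ≤ 1`, rows T2 / T4 / T8); class AD] -/
def ThetaMemSigma : Prop :=
  ∀ (φ : X.S), ∀ f ∈ X.isotypic, X.Θ φ f ∈ X.σ

/-- [interface: N3.L1 last clause / N3.2(f) — the lift of a `τ′`-isotypic vector by the forced Fock
datum has `K_∞^G`-type `τ` (`F_A` is of type `τ`; `⟨F_A, ψ⟩ = 0` for `ψ` of another type); class AD] -/
def ThetaTauType (τiso : Submodule ℂ LG) : Prop :=
  ∀ (φ : X.S), ∀ f ∈ X.τ'iso, X.Θ φ f ∈ τiso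

/-- [interface: N3.2(e) / N3.4 — the copies `π₀ ⊗ m_j` are `H(𝔸)`-equivariant images of `π₀`
(`π₀` is `R`-stable and `copy j` intertwines `R`); definitional (Π(π₀) ≅ π₀ ⊗ M(π₀)); class AD] -/
def CopiesEquivariant : Prop :=
  ∀ (j : Fin X.m₀) (g : X.Hf) (v : X.π₀),
    ∃ h : X.R g v ∈ X.π₀, (X.copy j ⟨X.R g v, h⟩ : X.LH) = X.R g (X.copy j v)

/-- [interface: N3.2(e) / N3.4 — the copies have pairwise orthogonal images (`(m_j)` orthonormal);
definitional; class AD] -/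
def CopiesOrthogonal : Prop :=
  ∀ i j : Fin X.m₀, i ≠ j → ∀ v w : X.π₀, ⟪(X.copy i v : X.LH), X.copy j w⟫_ℂ = 0

/-- [interface: N3.4 «the given copy being `π₀ ⊗ m₁`» — one of the copies is the inclusion of `π₀`
itself; definitional; class AD] -/
def CopiesIncl : Prop :=
  ∃ j : Fin X.m₀, ∀ v : X.π₀, (X.copy j v : X.LH) = v

/-- [interface: N3.2(e)–(f) — the copies preserve the `K_∞^H`-type `τ′` in both directions (the
isomorphism `Π(π₀) ≅ π₀ ⊗ M(π₀)` is `H(𝔸)`-equivariant, `K_∞^H ⊂ H(𝔸)`); class AD] -/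
def CopiesTauType : Prop :=
  ∀ (j : Fin X.m₀) (v : X.π₀), (X.copy j v : X.LH) ∈ X.τ'iso ↔ (v : X.LH) ∈ X.τ'iso

/-- [interface: N3.2(e)–(f) — the `τ′`-isotypic part of `Π(π₀)` decomposes along the copies: if a sum of
vectors from the copies is `τ′`-isotypic, so is each summand (the projections to the copies commute
with `K_∞^H`); class AD] -/
def TauTypeDecomposes : Prop :=
  ∀ v : Fin X.m₀ → X.π₀, (∑ j, (X.copy j (v j) : X.LH)) ∈ X.τ'iso →
    ∀ j, (X.copy j (v j) : X.LH) ∈ X.τ'iso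

/-- [interface: N3.2(e) «`Π(π₀)^{K,τ′}` is finite-dimensional: `π₀,f^K` finite-dimensional
(admissibility), `π₀,∞` admissible (`τ′`-isotypic part finite-dimensional), `m₀ < ∞`» (row T5,
Borel–Wallach (2.7)); class AD] -/
def LevelPartFinite : Prop :=
  FiniteDimensional ℂ X.levelPart

/-- [interface: N3.L6 «smooth vectors of the discrete spectrum on a compact quotient are continuous» —
`Π(π₀)^{K,τ′} ⊂ C([H])`; class AD] -/
def LevelPartCont : Prop :=
  X.levelPart ≤ X.Cont

/-- [interface: N3.L7 (the `K`-average) «for arbitrary `φ_f` the `K`-average `e_K φ_f` is `K`-fixed, and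
`Θ(u, φ₁₂,∞ ⊗ e_K φ_f) = ∫_K Θ(u, ω(k)φ) dk = ∫_K Θ(R(k^{∓1})u, φ) dk = Θ(u, φ)` — `u` `K`-fixed»;
class AD] -/
def KAverage : Prop :=
  ∀ φ : X.S, ∃ φ' ∈ X.SKfix, ∀ u ∈ X.Kfix, X.Θ φ' u = X.Θ φ u

/-- [interface: N3.L3 (equivariance) «`Θ(R(g′)f, φ) = Θ(f, ω(g′)⁻¹φ)`» (the direction of the exponent
is immaterial — every use is an invariance statement); class AD] -/
def ThetaEquivariant : Prop :=
  ∀ (g : X.Hf) (φ : X.S) (f : X.LH), X.Θ φ (X.R g f) = X.Θ (X.ωH g⁻¹ φ) f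

/-- [interface: row T7 / N3.L7 «write `u = u_∞ ⊗ u_f` with `u_∞` in the `τ′`-isotypic part of `π₀,∞` —
ONE-dimensional — so the `H(𝔸_f)`-span of `u` is `u_∞ ⊗ π₀,f` (`π₀,f` irreducible), which contains every
`f` with archimedean component in `τ′`», on each copy; class AD (Tier 5: [C] from [KK07] Thm 5.4)] -/
def SpanOfFixedVector : Prop :=
  ∀ j : Fin X.m₀, ∀ u ∈ LinearMap.range (X.copy j).toLinearMap ⊓ X.Kfix ⊓ X.τ'iso, u ≠ 0 →
    LinearMap.range (X.copy j).toLinearMap ⊓ X.τ'iso ≤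
      Submodule.span ℂ (Set.range fun g : X.Hf => X.R g u)

/-- [interface: N3.L4 (cross-copy orthogonality, from GQT Theorem 33(i) as printed, row T1, by the
four-copy polarisation) «`⟨Θ(v ⊗ m, φ₁), Θ(v₁ ⊗ m′, φ₂)⟩ = 0`» for orthonormal `m ≠ m′`; class AD] -/
def CrossCopyOrthogonal : Prop :=
  ∀ i j : Fin X.m₀, i ≠ j → ∀ (φ₁ φ₂ : X.S) (v w : X.π₀),
    ⟪X.Θ φ₁ (X.copy i v), X.Θ φ₂ (X.copy j w)⟫_ℂ = 0

/-- [interface: N3.L4 (copy independence, from GQT Theorem 33(i) as printed, row T1: «its right-hand side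
is the SAME number … for every `u`») «`⟨Θ(v ⊗ m, φ₁), Θ(v₁ ⊗ m, φ₂)⟩ = ⟨Θ(v ⊗ m′, φ₁), Θ(v₁ ⊗ m′, φ₂)⟩`»;
class AD] -/
def CopyIndependence : Prop :=
  ∀ (i j : Fin X.m₀) (φ₁ φ₂ : X.S) (v w : X.π₀),
    ⟪X.Θ φ₁ (X.copy i v), X.Θ φ₂ (X.copy i w)⟫_ℂ = ⟪X.Θ φ₁ (X.copy j v), X.Θ φ₂ (X.copy j w)⟫_ℂ

/-- [interface: N3.2(c) «`𝒮(𝕏(𝔸)) = 𝒮((V⊗W_a)(𝔸)) ⊗ 𝒮((V⊗W_b)(𝔸))`» — the pure tensors span the finite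
Schwartz data (algebraically); definitional; class AD] -/
def TensorsSpan : Prop :=
  ⊤ ≤ Submodule.span ℂ (Set.range fun p : X.Sa × X.Sb => X.tensor p.1 p.2)

end N3Side

namespace N3Datum

variable (𝒟 : N3Datum)

/-- [interface: N3.L8 (2) «holomorphic 1-forms multiply to holomorphic 2-forms, so `M_A ⊂ 𝒱` [I, N1]»
— products of vertex forms are `(2,0)`-forms of some level, i.e. lie in the τ-parts of the automorphic
`σ′`; class AD / interface with N1] -/
def ProductsIn20 (X : N3Side 𝒟.LG 𝒟.Gf) : Prop :=
  𝒟.productModule X ≤ 𝒟.V20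

/-- [interface: N3.L3 / N3.L8 (2) «`R(g′)(η_a(φ_a)η_b(φ_b)) = η_a(ω(g′)φ_a)η_b(ω(g′)φ_b)`» (`G(𝔸_f)`-
equivariance of the kernel in `φ`); class AD] -/
def ProductEquivariant (X : N3Side 𝒟.LG 𝒟.Gf) : Prop :=
  ∀ (g : 𝒟.Gf) (φa : X.Sa) (φb : X.Sb), 𝒟.ρ g (X.F φa φb) = X.F (X.ωGa g φa) (X.ωGb g φb)

/-- [interface: N3.L8 (1) — the τ-type part `σ′_f` of each automorphic `σ′` is a `G(𝔸_f)`-submodule;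
definitional; class AD] -/
def AutStable : Prop :=
  ∀ (i : 𝒟.Aut) (g : 𝒟.Gf), ∀ x ∈ 𝒟.aut i ⊓ 𝒟.τiso, 𝒟.ρ g x ∈ 𝒟.aut i ⊓ 𝒟.τiso

/-- [interface: N3.L8 (1) «each `σ′` contributing ONE copy of `σ′_f`» — `σ′_f` is an irreducible smooth
`G(𝔸_f)`-module (its archimedean component being fixed, `σ′^τ ≅ σ′_f`, row T7): every `ρ`-stable
subspace of `σ′ ⊓ τiso` is `⊥` or everything; class AD] -/
def AutSimple : Prop :=
  ∀ (i : 𝒟.Aut) (N : Submodule ℂ 𝒟.LG), N ≤ 𝒟.aut i ⊓ 𝒟.τiso →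
    (∀ g, ∀ x ∈ N, 𝒟.ρ g x ∈ N) → N = ⊥ ∨ N = 𝒟.aut i ⊓ 𝒟.τiso

/-- [interface: N3.L8 (1) «the summands are pairwise NON-isomorphic smooth `G(𝔸_f)`-modules (`σ′_f ≅ σ″_f`
with the same `σ′_∞ = σ″_∞` would make `σ′ ≅ σ″` abstractly, hence `σ′ = σ″` as subspaces by `m ≤ 1`,
rows T4 / T8)» — in the form Schur's lemma gives for simples: no non-zero `ρ`-equivariant linear map
between the τ-parts of distinct `σ′`; class AD] -/
def AutNonIso (hst : 𝒟.AutStable) : Prop :=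
  ∀ i j : 𝒟.Aut, i ≠ j → ∀ T : ↥(𝒟.aut i ⊓ 𝒟.τiso) →ₗ[ℂ] ↥(𝒟.aut j ⊓ 𝒟.τiso),
    (∀ (g : 𝒟.Gf) (x : ↥(𝒟.aut i ⊓ 𝒟.τiso)),
      (T ⟨𝒟.ρ g x, hst i g x x.2⟩ : 𝒟.LG) = 𝒟.ρ g (T x)) → T = 0

/-- [interface: N3.2(e) / N3.L8 (1) — distinct automorphic subrepresentations of `L²([G])` are orthogonal
(`L²([G]) = ⊕̂_{σ′} Π_G(σ′)`, row T5 for `[G]`); class AD] -/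
def AutOrthogonal : Prop :=
  ∀ i j : 𝒟.Aut, i ≠ j → ∀ x ∈ 𝒟.aut i, ∀ y ∈ 𝒟.aut j, ⟪x, y⟫_ℂ = 0

/-- [interface: N3.L8 (4) — the theta lift `σ` of the given side is one of the τ-type automorphic
subrepresentations (`σ^τ ≠ 0` once `ℓ^σ ≢ 0`; `σ_∞` is the `(2,0)`-cohomological module, N3.2(f));
class AD] -/
def SigmaIsAut (X : N3Side 𝒟.LG 𝒟.Gf) : Prop :=
  ∃ i : 𝒟.Aut, 𝒟.aut i = X.σ

end N3Datum

end Summit.Ventures.HodgeRepro2.T6
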